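import Summits.AnomalousDissipation.AnomalousDissipation.Theorems.SolenoidalFractalHomogenisationLagrangianStepVmodShortPieces
import HarnessLib

/-!
# K1L_D (stmt-AnomalousDissipation-27980): (V_mod) flat stage — the SHORT-WINDOW CORE in loss currency (abstract form)
(line file of the (V_mod) lane, short-window engine F4c-2 of the (ff) block (and of (fs)/(sf)); prover ad-k3l-bookkeeping-p1 g9.)

**`short_window_core`.**  `T` the carrier-free window propagator of an elliptic tensor `𝔹T` (`NearIso 𝔹T loT hiT`, `0 < loT`), `V` the carrier-free
propagator of another tensor, `U'` any contraction of `V2`, `0 ≤ s < t ≤ T₀`, `κτ = 8π²·loT·(t−s)`.  ASSUME the three analytic inputs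
(i) `|⟪U'x, ζ⟫ − ⟪V s t x, ζ⟫| ≤ A‖x‖·‖∇ζ‖` for solenoidal tests of finite enstrophy (this seat's `abs_inner_sub_inner_driftFree_le`, p711768, with
`A = 3B(t−s)`), (ii) the same with the roles of datum and test exchanged (its adjoint form), (iii) `|⟪V s t x, ζ⟫ − ⟪T s t x, ζ⟫| ≤ D·Σ_{k∈S}|k|²‖x̂ k‖‖ζ̂ k‖`
for solenoidal `x, ζ` with `ζ̂` finitely supported (this seat's `abs_inner_sub_inner_tensorChange_le`, p712341, `D = 4π²(K₁+K₂)(t−s)`).  THEN for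
solenoidal `x, ζ` with ONE of them fast at resolution `n` (`m = (n/4)²+1`) and a split level `N` with `κτN² ≤ 1 ≤ κτ(N+1)²`:
`|⟪U'x − T s t x, ζ⟫| ≤ (4πA/(κτ√m) + 8√2πA/√κτ + 2D/κτ + 16)·√(lossFwd (T s t) x)·√(lossAdj (T s t) ζ)`.
Proof: split both classes at the ball `|k| ≤ N` (`…VmodShortPieces`); the four cells of `U' − V` are paid by (i)/(ii) in the currencies of the pieces
(low: enstrophy `(κτ/2)Σ|k|²|·̂|² ≤ q`; high: saturation `‖·‖²/4 ≤ q`; a FAST low piece has `m‖xu‖² ≤ Σ|k|²‖x̂ k‖²`), the diagonal cells of `V − T` by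
(iii) and Cauchy–Schwarz, its off-diagonal cells vanish (multipliers), and `LossCurrency.lossBound_add_blocks` adds the cells.  In the (ff)/(fs)/(sf)
blocks `A/κτ = 3B/κ = O(ν)·n⁻¹…`, `A/√κτ ≤ 3B√(P/κ) = O(1)` for `t − s ≤ P = M·W.period/ν`, `D/κτ = (K₁+K₂)/(2loT) = O(1)` (next file).
`sorry`-free; NOT a proof of any block, of the stub, of K1L_D or AD; rung F-D1.A0.
-/

set_option linter.dupNamespace false

noncomputable section

namespace Summit.AnomalousDissipation.AnomalousDissipation.Theorems.SolenoidalFractalHomogenisation.LagrangianStep.VmodFlat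

open Literature.Analysis Literature.Analysis.FluidPDE Literature.Analysis.FunctionSpaces
open MeasureTheory Set Filter UnitAddTorus
open scoped ENNReal NNReal InnerProductSpace
open Summit.AnomalousDissipation.AnomalousDissipation.Theorems.SolenoidalFractalHomogenisation.LagrangianStep.CellClauseMod

/-! ## The short-window core (abstract form) -/

section Core

/-- From `c·Z ≤ q` (`c > 0`, `Z ≥ 0`): `√Z ≤ (1/√c)·√q`. [folklore] -/
theorem sqrt_le_of_mul_le {c Z q : ℝ} (hc : 0 < c) (h : c * Z ≤ q) : Real.sqrt Z ≤ (1 / Real.sqrt c) * Real.sqrt q := by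
  have hZ : Z ≤ q / c := by rw [le_div_iff₀ hc]; linarith
  calc Real.sqrt Z ≤ Real.sqrt (q / c) := Real.sqrt_le_sqrt hZ
    _ = (1 / Real.sqrt c) * Real.sqrt q := by rw [Real.sqrt_div' _ hc.le]; ring

set_option maxHeartbeats 1600000 in
/-- **SHORT-WINDOW CORE (abstract form).**  Let `T` be the carrier-free window propagator of an elliptic tensor `𝔹T` (`NearIso 𝔹T loT hiT`, `0 < loT`)
and `V` the carrier-free propagator of another (`𝔹V`), `U'` a contraction of `V2`, `0 ≤ s < t ≤ T₀`, `κτ := 8π²·loT·(t − s)`, and suppose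
* `|⟪U' x, ζ⟫ − ⟪V s t x, ζ⟫| ≤ A·‖x‖·√(eGradNormSq ζ)` for weakly divergence-free `ζ` of finite enstrophy (transport vs. a smooth TEST),
* `|⟪U' x, ζ⟫ − ⟪V s t x, ζ⟫| ≤ A·‖ζ‖·√(eGradNormSq x)` for weakly divergence-free `x` of finite enstrophy (transport vs. a smooth DATUM),
* `|⟪V s t x, ζ⟫ − ⟪T s t x, ζ⟫| ≤ D·Σ_{k∈S} |k|²‖x̂ k‖‖ζ̂ k‖` for weakly divergence-free `x, ζ`, `ζ̂` supported in the finite `S` (tensor change).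
Then for weakly divergence-free `x, ζ`, ONE of them fast at resolution `n` (`m := (n/4)² + 1`), and a split level `N` with `κτ·N² ≤ 1 ≤ κτ·(N+1)²`:
`|⟪U' x − T s t x, ζ⟫| ≤ (4πA/(κτ√m) + 8√2·π·A/√(κτ) + 2D/(κτ) + 16)·√(lossFwd (T s t) x)·√(lossAdj (T s t) ζ)`. [folklore] -/
theorem short_window_core {T₀ : ℝ} {𝔹V 𝔹T : Torus.Visc4 (Fin 3)} {loV hiV loT hiT : ℝ} (h𝔹V : Torus.NearIso 𝔹V loV hiV) (hloV : 0 < loV)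
    (h𝔹T : Torus.NearIso 𝔹T loT hiT) (hloT : 0 < loT) {V T : ℝ → ℝ → (V2 →L[ℝ] V2)}
    (hV : Torus.IsPropagator T₀ (fun (_ : ℝ) (_ : UnitAddTorus (Fin 3)) => (0 : EuclideanSpace ℝ (Fin 3))) 𝔹V V)
    (hT : Torus.IsPropagator T₀ (fun (_ : ℝ) (_ : UnitAddTorus (Fin 3)) => (0 : EuclideanSpace ℝ (Fin 3))) 𝔹T T)
    (U' : V2 →L[ℝ] V2) (hU' : ∀ y, ‖U' y‖ ≤ ‖y‖) {s t : ℝ} (hs : 0 ≤ s) (hst : s < t) (htT : t ≤ T₀) {A D : ℝ} (hA : 0 ≤ A) (hD : 0 ≤ D)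
    (hUV : ∀ x ζ : V2, Torus.IsWeaklyDivFree (ζ : VF) → Torus.eGradNormSq (ζ : VF) ≠ ⊤ →
      |⟪U' x, ζ⟫_ℝ - ⟪V s t x, ζ⟫_ℝ| ≤ A * ‖x‖ * Real.sqrt ((Torus.eGradNormSq (ζ : VF)).toReal))
    (hUV' : ∀ x ζ : V2, Torus.IsWeaklyDivFree (x : VF) → Torus.eGradNormSq (x : VF) ≠ ⊤ →
      |⟪U' x, ζ⟫_ℝ - ⟪V s t x, ζ⟫_ℝ| ≤ A * ‖ζ‖ * Real.sqrt ((Torus.eGradNormSq (x : VF)).toReal))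
    (hVT : ∀ (x ζ : V2) (S : Finset (Fin 3 → ℤ)), Torus.IsWeaklyDivFree (x : VF) → Torus.IsWeaklyDivFree (ζ : VF) →
      (∀ k, k ∉ S → fc ζ k = 0) →
      |⟪V s t x, ζ⟫_ℝ - ⟪T s t x, ζ⟫_ℝ| ≤ D * ∑ k ∈ S, Torus.freqNormSq k * (‖fc x k‖ * ‖fc ζ k‖))
    (N : ℕ) (hN1 : 8 * Real.pi ^ 2 * loT * (t - s) * (N : ℝ) ^ 2 ≤ 1) (hN2 : 1 ≤ 8 * Real.pi ^ 2 * loT * (t - s) * ((N : ℝ) + 1) ^ 2)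
    {n : ℕ} (x ζ : V2) (hx : Torus.IsWeaklyDivFree (x : VF)) (hζ : Torus.IsWeaklyDivFree (ζ : VF)) (hfast : IsFast n x ∨ IsFast n ζ) :
    |⟪U' x - T s t x, ζ⟫_ℝ| ≤
      (4 * Real.pi * A / (8 * Real.pi ^ 2 * loT * (t - s) * Real.sqrt ((((n / 4 : ℕ) : ℝ)) ^ 2 + 1)) +
          8 * Real.sqrt 2 * Real.pi * A / Real.sqrt (8 * Real.pi ^ 2 * loT * (t - s)) +
          2 * D / (8 * Real.pi ^ 2 * loT * (t - s)) + 16) *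
        Real.sqrt (lossFwd (T s t) x) * Real.sqrt (lossAdj (T s t) ζ) := by
  -- abbreviations
  set κτ : ℝ := 8 * Real.pi ^ 2 * loT * (t - s) with hκτ
  have hτ0 : 0 < t - s := sub_pos.2 hst
  have hκτ0 : 0 < κτ := by rw [hκτ]; positivity
  set m : ℝ := (((n / 4 : ℕ) : ℝ)) ^ 2 + 1 with hmdef
  have hm0 : 0 < m := by rw [hmdef]; positivity
  -- the splits
  obtain ⟨xu, xs, hxsum, hfxu, hfxs, hEx, hxdiv⟩ := exists_ballSplit N x
  obtain ⟨hxu, hxs⟩ := hxdiv hx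
  obtain ⟨ζu, ζs, hζsum, hfζu, hfζs, hEζ, hζdiv'⟩ := exists_ballSplit N ζ
  obtain ⟨hζu, hζs⟩ := hζdiv' hζ
  obtain ⟨hExtop, hExR⟩ := eGradNormSq_low_toReal hEx
  obtain ⟨hEζtop, hEζR⟩ := eGradNormSq_low_toReal hEζ
  set Zx : ℝ := ∑ k ∈ Torus.freqBall (d := Fin 3) N, Torus.freqNormSq k * ‖fc x k‖ ^ 2 with hZx
  set Zζ : ℝ := ∑ k ∈ Torus.freqBall (d := Fin 3) N, Torus.freqNormSq k * ‖fc ζ k‖ ^ 2 with hZζ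
  have hZx0 : 0 ≤ Zx := Finset.sum_nonneg fun k _ => mul_nonneg (Torus.freqNormSq_nonneg k) (sq_nonneg _)
  have hZζ0 : 0 ≤ Zζ := Finset.sum_nonneg fun k _ => mul_nonneg (Torus.freqNormSq_nonneg k) (sq_nonneg _)
  -- the currencies
  set qu := lossFwd (T s t) xu with hqu
  set qs := lossFwd (T s t) xs with hqs
  set pu := lossAdj (T s t) ζu with hpu
  set ps := lossAdj (T s t) ζs with hps
  have hTn : ∀ y, ‖T s t y‖ ≤ ‖y‖ := hT.norm_le s t
  have hqu0 : 0 ≤ qu := LossCurrency.loss_nonneg hTn xu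
  have hqs0 : 0 ≤ qs := LossCurrency.loss_nonneg hTn xs
  have hpu0 : 0 ≤ pu := LossCurrency.lossAdj_nonneg hTn ζu
  have hps0 : 0 ≤ ps := LossCurrency.lossAdj_nonneg hTn ζs
  have hq_split : lossFwd (T s t) x = qu + qs := lossFwd_ballSplit h𝔹T hloT hT hs hst.le htT hxsum hfxu hfxs hxu hxs
  have hp_split : lossAdj (T s t) ζ = pu + ps := lossAdj_ballSplit h𝔹T hloT hT hs hst.le htT hζsum hfζu hfζs hζu hζs
  -- low pieces: enstrophy currency `κτ/2 · Z ≤ q`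
  have hZx_le : κτ / 2 * Zx ≤ qu := lossFwd_low_ge h𝔹T hloT (fun _ _ => rfl) hT hs hst.le htT hfxu hxu hN1
  have hZζ_le : κτ / 2 * Zζ ≤ pu := lossAdj_low_ge h𝔹T hloT hT hs hst.le htT hfζu hζu hN1
  -- high pieces: saturated `‖·‖²/4 ≤ q`
  have hxs_le : ‖xs‖ ^ 2 / 4 ≤ qs := lossFwd_high_ge h𝔹T hloT (fun _ _ => rfl) hT hs hst.le htT hfxs hN2
  have hζs_le : ‖ζs‖ ^ 2 / 4 ≤ ps := lossAdj_high_ge h𝔹T hloT hT hs hst.le htT hfζs hN2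
  -- square roots
  have hc2 : 0 < κτ / 2 := by positivity
  have hsZx : Real.sqrt Zx ≤ (1 / Real.sqrt (κτ / 2)) * Real.sqrt qu := sqrt_le_of_mul_le hc2 hZx_le
  have hsZζ : Real.sqrt Zζ ≤ (1 / Real.sqrt (κτ / 2)) * Real.sqrt pu := sqrt_le_of_mul_le hc2 hZζ_le
  have hsxs : ‖xs‖ ≤ 2 * Real.sqrt qs := by
    have h1 : (1:ℝ) / 4 * ‖xs‖ ^ 2 ≤ qs := by linarith
    have h2 := sqrt_le_of_mul_le (by norm_num : (0:ℝ) < 1 / 4) h1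
    rw [Real.sqrt_sq (norm_nonneg _)] at h2
    have e : (1:ℝ) / Real.sqrt (1 / 4) = 2 := by
      rw [show (1:ℝ) / 4 = (1 / 2) ^ 2 by norm_num, Real.sqrt_sq (by norm_num : (0:ℝ) ≤ 1 / 2)]; norm_num
    rwa [e] at h2
  have hsζs : ‖ζs‖ ≤ 2 * Real.sqrt ps := by
    have h1 : (1:ℝ) / 4 * ‖ζs‖ ^ 2 ≤ ps := by linarith
    have h2 := sqrt_le_of_mul_le (by norm_num : (0:ℝ) < 1 / 4) h1
    rw [Real.sqrt_sq (norm_nonneg _)] at h2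
    have e : (1:ℝ) / Real.sqrt (1 / 4) = 2 := by
      rw [show (1:ℝ) / 4 = (1 / 2) ^ 2 by norm_num, Real.sqrt_sq (by norm_num : (0:ℝ) ≤ 1 / 2)]; norm_num
    rwa [e] at h2
  -- enstrophies of the low pieces
  have hEx' : Real.sqrt ((Torus.eGradNormSq (xu : VF)).toReal) = 2 * Real.pi * Real.sqrt Zx := by
    rw [hExR, show 4 * Real.pi ^ 2 * Zx = (2 * Real.pi) ^ 2 * Zx by ring, Real.sqrt_mul (sq_nonneg _), Real.sqrt_sq (by positivity)]
  have hEζ' : Real.sqrt ((Torus.eGradNormSq (ζu : VF)).toReal) = 2 * Real.pi * Real.sqrt Zζ := by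
    rw [hEζR, show 4 * Real.pi ^ 2 * Zζ = (2 * Real.pi) ^ 2 * Zζ by ring, Real.sqrt_mul (sq_nonneg _), Real.sqrt_sq (by positivity)]
  have h1c : 1 / Real.sqrt (κτ / 2) = Real.sqrt 2 / Real.sqrt κτ := by
    rw [Real.sqrt_div' _ (by norm_num : (0:ℝ) ≤ 2)]
    field_simp
  -- ### the transport part `M₁ = U' − V s t`
  set M₁ : V2 →L[ℝ] V2 := U' - V s t with hM₁
  have hM₁ap : ∀ y z : V2, ⟪M₁ y, z⟫_ℝ = ⟪U' y, z⟫_ℝ - ⟪V s t y, z⟫_ℝ := fun y z => by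
    simp only [hM₁, FunLike.coe_sub, Pi.sub_apply, inner_sub_left]
  have hM₁n : ∀ y z : V2, |⟪M₁ y, z⟫_ℝ| ≤ 2 * ‖y‖ * ‖z‖ := fun y z => by
    rw [hM₁ap, ← inner_sub_left]
    refine (abs_real_inner_le_norm _ _).trans ?_
    calc ‖U' y - V s t y‖ * ‖z‖ ≤ (‖U' y‖ + ‖V s t y‖) * ‖z‖ := mul_le_mul_of_nonneg_right (norm_sub_le _ _) (norm_nonneg _)
      _ ≤ (‖y‖ + ‖y‖) * ‖z‖ := mul_le_mul_of_nonneg_right (add_le_add (hU' y) (hV.norm_le s t y)) (norm_nonneg _)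
      _ = 2 * ‖y‖ * ‖z‖ := by ring
  set M₂ : V2 →L[ℝ] V2 := V s t - T s t with hM₂
  have hM₂ap : ∀ y z : V2, ⟪M₂ y, z⟫_ℝ = ⟪V s t y, z⟫_ℝ - ⟪T s t y, z⟫_ℝ := fun y z => by
    simp only [hM₂, FunLike.coe_sub, Pi.sub_apply, inner_sub_left]
  have hM₂n : ∀ y z : V2, |⟪M₂ y, z⟫_ℝ| ≤ 2 * ‖y‖ * ‖z‖ := fun y z => by
    rw [hM₂ap, ← inner_sub_left]
    refine (abs_real_inner_le_norm _ _).trans ?_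
    calc ‖V s t y - T s t y‖ * ‖z‖ ≤ (‖V s t y‖ + ‖T s t y‖) * ‖z‖ := mul_le_mul_of_nonneg_right (norm_sub_le _ _) (norm_nonneg _)
      _ ≤ (‖y‖ + ‖y‖) * ‖z‖ := mul_le_mul_of_nonneg_right (add_le_add (hV.norm_le s t y) (hT.norm_le s t y)) (norm_nonneg _)
      _ = 2 * ‖y‖ * ‖z‖ := by ring
  -- coefficient of the (u,u) cell
  set ηuu : ℝ := 4 * Real.pi * A / (κτ * Real.sqrt m) with hηuu
  have hηuu0 : 0 ≤ ηuu := by rw [hηuu]; positivity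
  set ηus : ℝ := 4 * Real.sqrt 2 * Real.pi * A / Real.sqrt κτ with hηus
  have hηus0 : 0 ≤ ηus := by rw [hηus]; positivity
  -- (u,u)
  have h11 : |⟪M₁ xu, ζu⟫_ℝ| ≤ ηuu * Real.sqrt qu * Real.sqrt pu := by
    rw [hM₁ap]
    rcases hfast with hxf | hζf
    · -- fast datum: `‖xu‖ ≤ √Zx/√m`, test in enstrophy
      have hb := hUV xu ζu hζu hEζtop
      rw [hEζ'] at hb
      have hxu_n : ‖xu‖ ≤ (1 / Real.sqrt m) * Real.sqrt Zx := by
        have h1 : m * ‖xu‖ ^ 2 ≤ Zx := norm_sq_low_le_of_isFast hxf hfxu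
        have h2 := sqrt_le_of_mul_le hm0 h1
        rwa [Real.sqrt_sq (norm_nonneg _)] at h2
      calc |⟪U' xu, ζu⟫_ℝ - ⟪V s t xu, ζu⟫_ℝ| ≤ A * ‖xu‖ * (2 * Real.pi * Real.sqrt Zζ) := hb
        _ ≤ A * ((1 / Real.sqrt m) * Real.sqrt Zx) * (2 * Real.pi * Real.sqrt Zζ) := by gcongr
        _ = (2 * Real.pi * A / Real.sqrt m) * (Real.sqrt Zx * Real.sqrt Zζ) := by
            field_simp
        _ ≤ (2 * Real.pi * A / Real.sqrt m) * (((1 / Real.sqrt (κτ / 2)) * Real.sqrt qu) * ((1 / Real.sqrt (κτ / 2)) * Real.sqrt pu)) := by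
            gcongr
        _ = ηuu * Real.sqrt qu * Real.sqrt pu := by
            rw [hηuu]
            have e2 : (1 / Real.sqrt (κτ / 2)) * (1 / Real.sqrt (κτ / 2)) = 2 / κτ := by
              rw [div_mul_div_comm, one_mul, ← pow_two, Real.sq_sqrt hc2.le]; field_simp
            calc (2 * Real.pi * A / Real.sqrt m) * (((1 / Real.sqrt (κτ / 2)) * Real.sqrt qu) * ((1 / Real.sqrt (κτ / 2)) * Real.sqrt pu))
                = (2 * Real.pi * A / Real.sqrt m) * ((1 / Real.sqrt (κτ / 2)) * (1 / Real.sqrt (κτ / 2))) * Real.sqrt qu * Real.sqrt pu := by ring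
              _ = 4 * Real.pi * A / (κτ * Real.sqrt m) * Real.sqrt qu * Real.sqrt pu := by rw [e2]; field_simp; ring
    · -- fast test: symmetric, via the datum-side bound
      have hb := hUV' xu ζu hxu hExtop
      rw [hEx'] at hb
      have hζu_n : ‖ζu‖ ≤ (1 / Real.sqrt m) * Real.sqrt Zζ := by
        have h1 : m * ‖ζu‖ ^ 2 ≤ Zζ := norm_sq_low_le_of_isFast hζf hfζu
        have h2 := sqrt_le_of_mul_le hm0 h1
        rwa [Real.sqrt_sq (norm_nonneg _)] at h2
      calc |⟪U' xu, ζu⟫_ℝ - ⟪V s t xu, ζu⟫_ℝ| ≤ A * ‖ζu‖ * (2 * Real.pi * Real.sqrt Zx) := hb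
        _ ≤ A * ((1 / Real.sqrt m) * Real.sqrt Zζ) * (2 * Real.pi * Real.sqrt Zx) := by gcongr
        _ = (2 * Real.pi * A / Real.sqrt m) * (Real.sqrt Zx * Real.sqrt Zζ) := by
            field_simp
        _ ≤ (2 * Real.pi * A / Real.sqrt m) * (((1 / Real.sqrt (κτ / 2)) * Real.sqrt qu) * ((1 / Real.sqrt (κτ / 2)) * Real.sqrt pu)) := by
            gcongr
        _ = ηuu * Real.sqrt qu * Real.sqrt pu := by
            rw [hηuu]
            have e2 : (1 / Real.sqrt (κτ / 2)) * (1 / Real.sqrt (κτ / 2)) = 2 / κτ := by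
              rw [div_mul_div_comm, one_mul, ← pow_two, Real.sq_sqrt hc2.le]; field_simp
            calc (2 * Real.pi * A / Real.sqrt m) * (((1 / Real.sqrt (κτ / 2)) * Real.sqrt qu) * ((1 / Real.sqrt (κτ / 2)) * Real.sqrt pu))
                = (2 * Real.pi * A / Real.sqrt m) * ((1 / Real.sqrt (κτ / 2)) * (1 / Real.sqrt (κτ / 2))) * Real.sqrt qu * Real.sqrt pu := by ring
              _ = 4 * Real.pi * A / (κτ * Real.sqrt m) * Real.sqrt qu * Real.sqrt pu := by rw [e2]; field_simp; ring
  -- (s-datum, u-test)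
  have h21 : |⟪M₁ xs, ζu⟫_ℝ| ≤ ηus * Real.sqrt qs * Real.sqrt pu := by
    rw [hM₁ap]
    have hb := hUV xs ζu hζu hEζtop
    rw [hEζ'] at hb
    calc |⟪U' xs, ζu⟫_ℝ - ⟪V s t xs, ζu⟫_ℝ| ≤ A * ‖xs‖ * (2 * Real.pi * Real.sqrt Zζ) := hb
      _ ≤ A * (2 * Real.sqrt qs) * (2 * Real.pi * ((1 / Real.sqrt (κτ / 2)) * Real.sqrt pu)) := by gcongr
      _ = ηus * Real.sqrt qs * Real.sqrt pu := by rw [hηus, h1c]; ring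
  -- (u-datum, s-test)
  have h12 : |⟪M₁ xu, ζs⟫_ℝ| ≤ ηus * Real.sqrt qu * Real.sqrt ps := by
    rw [hM₁ap]
    have hb := hUV' xu ζs hxu hExtop
    rw [hEx'] at hb
    calc |⟪U' xu, ζs⟫_ℝ - ⟪V s t xu, ζs⟫_ℝ| ≤ A * ‖ζs‖ * (2 * Real.pi * Real.sqrt Zx) := hb
      _ ≤ A * (2 * Real.sqrt ps) * (2 * Real.pi * ((1 / Real.sqrt (κτ / 2)) * Real.sqrt qu)) := by gcongr
      _ = ηus * Real.sqrt qu * Real.sqrt ps := by rw [hηus, h1c]; ring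
  -- (s,s)
  have h22 : |⟪M₁ xs, ζs⟫_ℝ| ≤ 8 * Real.sqrt qs * Real.sqrt ps := by
    calc |⟪M₁ xs, ζs⟫_ℝ| ≤ 2 * ‖xs‖ * ‖ζs‖ := hM₁n xs ζs
      _ ≤ 2 * (2 * Real.sqrt qs) * (2 * Real.sqrt ps) := by gcongr
      _ = 8 * Real.sqrt qs * Real.sqrt ps := by ring
  have hAq : Real.sqrt qu ^ 2 + Real.sqrt qs ^ 2 ≤ Real.sqrt (lossFwd (T s t) x) ^ 2 := by
    rw [Real.sq_sqrt hqu0, Real.sq_sqrt hqs0, Real.sq_sqrt (by rw [hq_split]; positivity), hq_split]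
  have hBp : Real.sqrt pu ^ 2 + Real.sqrt ps ^ 2 ≤ Real.sqrt (lossAdj (T s t) ζ) ^ 2 := by
    rw [Real.sq_sqrt hpu0, Real.sq_sqrt hps0, Real.sq_sqrt (by rw [hp_split]; positivity), hp_split]
  have hM₁tot : |⟪M₁ x, ζ⟫_ℝ| ≤ (ηuu + ηus + ηus + 8) * Real.sqrt (lossFwd (T s t) x) * Real.sqrt (lossAdj (T s t) ζ) := by
    have e' : ⟪M₁ x, ζ⟫_ℝ = ⟪M₁ xu + M₁ xs, ζu + ζs⟫_ℝ := by rw [← map_add, hxsum, hζsum]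
    rw [e']
    exact LossCurrency.lossBound_add_blocks h11 h12 h21 h22 hηuu0 hηus0 hηus0 (by norm_num) (Real.sqrt_nonneg _) (Real.sqrt_nonneg _)
      (Real.sqrt_nonneg _) (Real.sqrt_nonneg _) hAq hBp
  -- ### the tensor part `M₂ = V s t − T s t`
  set η'uu : ℝ := 2 * D / κτ with hη'uu
  have hη'uu0 : 0 ≤ η'uu := by rw [hη'uu]; positivity
  -- (u,u): the modewise tensor change, Cauchy–Schwarz over the ball
  have g11 : |⟪M₂ xu, ζu⟫_ℝ| ≤ η'uu * Real.sqrt qu * Real.sqrt pu := by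
    rw [hM₂ap]
    have hb := hVT xu ζu (Torus.freqBall (d := Fin 3) N) hxu hζu (fun k hk => by rw [hfζu k, if_neg hk])
    have hCS : ∑ k ∈ Torus.freqBall (d := Fin 3) N, Torus.freqNormSq k * (‖fc xu k‖ * ‖fc ζu k‖) ≤ Real.sqrt Zx * Real.sqrt Zζ := by
      have h := Real.sum_mul_le_sqrt_mul_sqrt (Torus.freqBall (d := Fin 3) N)
        (fun k => Real.sqrt (Torus.freqNormSq k) * ‖fc x k‖) (fun k => Real.sqrt (Torus.freqNormSq k) * ‖fc ζ k‖)
      have e1 : ∑ k ∈ Torus.freqBall (d := Fin 3) N, Torus.freqNormSq k * (‖fc xu k‖ * ‖fc ζu k‖) =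
          ∑ k ∈ Torus.freqBall (d := Fin 3) N, (Real.sqrt (Torus.freqNormSq k) * ‖fc x k‖) * (Real.sqrt (Torus.freqNormSq k) * ‖fc ζ k‖) := by
        refine Finset.sum_congr rfl fun k hk => ?_
        rw [hfxu k, hfζu k, if_pos hk, if_pos hk]
        have := Real.mul_self_sqrt (Torus.freqNormSq_nonneg k)
        calc Torus.freqNormSq k * (‖fc x k‖ * ‖fc ζ k‖) = (Real.sqrt (Torus.freqNormSq k) * Real.sqrt (Torus.freqNormSq k)) * (‖fc x k‖ * ‖fc ζ k‖) := by rw [this]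
          _ = _ := by ring
      have e2 : ∑ k ∈ Torus.freqBall (d := Fin 3) N, (Real.sqrt (Torus.freqNormSq k) * ‖fc x k‖) ^ 2 = Zx := by
        rw [hZx]; refine Finset.sum_congr rfl fun k _ => ?_
        rw [mul_pow, Real.sq_sqrt (Torus.freqNormSq_nonneg k)]
      have e3 : ∑ k ∈ Torus.freqBall (d := Fin 3) N, (Real.sqrt (Torus.freqNormSq k) * ‖fc ζ k‖) ^ 2 = Zζ := by
        rw [hZζ]; refine Finset.sum_congr rfl fun k _ => ?_
        rw [mul_pow, Real.sq_sqrt (Torus.freqNormSq_nonneg k)]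
      rw [e1]; rw [e2, e3] at h; exact h
    calc |⟪V s t xu, ζu⟫_ℝ - ⟪T s t xu, ζu⟫_ℝ| ≤ D * ∑ k ∈ Torus.freqBall (d := Fin 3) N, Torus.freqNormSq k * (‖fc xu k‖ * ‖fc ζu k‖) := hb
      _ ≤ D * (Real.sqrt Zx * Real.sqrt Zζ) := mul_le_mul_of_nonneg_left hCS hD
      _ ≤ D * (((1 / Real.sqrt (κτ / 2)) * Real.sqrt qu) * ((1 / Real.sqrt (κτ / 2)) * Real.sqrt pu)) := by
          gcongr
      _ = η'uu * Real.sqrt qu * Real.sqrt pu := by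
          rw [hη'uu]
          have e2 : (1 / Real.sqrt (κτ / 2)) * (1 / Real.sqrt (κτ / 2)) = 2 / κτ := by
            rw [div_mul_div_comm, one_mul, ← pow_two, Real.sq_sqrt hc2.le]; field_simp
          calc D * (((1 / Real.sqrt (κτ / 2)) * Real.sqrt qu) * ((1 / Real.sqrt (κτ / 2)) * Real.sqrt pu))
              = D * ((1 / Real.sqrt (κτ / 2)) * (1 / Real.sqrt (κτ / 2))) * Real.sqrt qu * Real.sqrt pu := by ring
            _ = 2 * D / κτ * Real.sqrt qu * Real.sqrt pu := by rw [e2]; field_simp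
  -- (u,s) and (s,u): zero by supports
  have hV0 : ∀ {y : V2}, Torus.IsWeaklyDivFree (y : VF) → ∀ k, fc y k = 0 → fc (V s t y) k = 0 := fun hy k hk =>
    fc_apply_eq_zero_of_carrier_zero h𝔹V hloV (fun _ _ => rfl) hV hs hst.le htT _ hy hk
  have hT0 : ∀ {y : V2}, Torus.IsWeaklyDivFree (y : VF) → ∀ k, fc y k = 0 → fc (T s t y) k = 0 := fun hy k hk =>
    fc_apply_eq_zero_of_carrier_zero h𝔹T hloT (fun _ _ => rfl) hT hs hst.le htT _ hy hk
  have g12 : |⟪M₂ xu, ζs⟫_ℝ| ≤ 0 * Real.sqrt qu * Real.sqrt ps := by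
    rw [zero_mul, zero_mul, hM₂ap]
    have h1 : ⟪V s t xu, ζs⟫_ℝ = 0 := inner_eq_zero_of_fc_disjoint fun k => by
      by_cases hk : k ∈ Torus.freqBall (d := Fin 3) N
      · right; rw [hfζs k, if_pos hk]
      · left; exact hV0 hxu k (by rw [hfxu k, if_neg hk])
    have h2 : ⟪T s t xu, ζs⟫_ℝ = 0 := inner_eq_zero_of_fc_disjoint fun k => by
      by_cases hk : k ∈ Torus.freqBall (d := Fin 3) N
      · right; rw [hfζs k, if_pos hk]
      · left; exact hT0 hxu k (by rw [hfxu k, if_neg hk])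
    rw [h1, h2, sub_self, abs_zero]
  have g21 : |⟪M₂ xs, ζu⟫_ℝ| ≤ 0 * Real.sqrt qs * Real.sqrt pu := by
    rw [zero_mul, zero_mul, hM₂ap]
    have h1 : ⟪V s t xs, ζu⟫_ℝ = 0 := inner_eq_zero_of_fc_disjoint fun k => by
      by_cases hk : k ∈ Torus.freqBall (d := Fin 3) N
      · left; exact hV0 hxs k (by rw [hfxs k, if_pos hk])
      · right; rw [hfζu k, if_neg hk]
    have h2 : ⟪T s t xs, ζu⟫_ℝ = 0 := inner_eq_zero_of_fc_disjoint fun k => by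
      by_cases hk : k ∈ Torus.freqBall (d := Fin 3) N
      · left; exact hT0 hxs k (by rw [hfxs k, if_pos hk])
      · right; rw [hfζu k, if_neg hk]
    rw [h1, h2, sub_self, abs_zero]
  have g22 : |⟪M₂ xs, ζs⟫_ℝ| ≤ 8 * Real.sqrt qs * Real.sqrt ps := by
    calc |⟪M₂ xs, ζs⟫_ℝ| ≤ 2 * ‖xs‖ * ‖ζs‖ := hM₂n xs ζs
      _ ≤ 2 * (2 * Real.sqrt qs) * (2 * Real.sqrt ps) := by gcongr
      _ = 8 * Real.sqrt qs * Real.sqrt ps := by ring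
  have hM₂tot : |⟪M₂ x, ζ⟫_ℝ| ≤ (η'uu + 0 + 0 + 8) * Real.sqrt (lossFwd (T s t) x) * Real.sqrt (lossAdj (T s t) ζ) := by
    have e' : ⟪M₂ x, ζ⟫_ℝ = ⟪M₂ xu + M₂ xs, ζu + ζs⟫_ℝ := by rw [← map_add, hxsum, hζsum]
    rw [e']
    exact LossCurrency.lossBound_add_blocks g11 g12 g21 g22 hη'uu0 le_rfl le_rfl (by norm_num) (Real.sqrt_nonneg _) (Real.sqrt_nonneg _)
      (Real.sqrt_nonneg _) (Real.sqrt_nonneg _) hAq hBp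
  -- ### total
  have e : ⟪U' x - T s t x, ζ⟫_ℝ = ⟪M₁ x, ζ⟫_ℝ + ⟪M₂ x, ζ⟫_ℝ := by
    rw [hM₁ap, hM₂ap, inner_sub_left]; ring
  rw [e]
  calc |⟪M₁ x, ζ⟫_ℝ + ⟪M₂ x, ζ⟫_ℝ| ≤ |⟪M₁ x, ζ⟫_ℝ| + |⟪M₂ x, ζ⟫_ℝ| := abs_add_le _ _
    _ ≤ (ηuu + ηus + ηus + 8) * Real.sqrt (lossFwd (T s t) x) * Real.sqrt (lossAdj (T s t) ζ) +
        (η'uu + 0 + 0 + 8) * Real.sqrt (lossFwd (T s t) x) * Real.sqrt (lossAdj (T s t) ζ) := add_le_add hM₁tot hM₂tot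
    _ = (4 * Real.pi * A / (κτ * Real.sqrt m) + 8 * Real.sqrt 2 * Real.pi * A / Real.sqrt κτ + 2 * D / κτ + 16) *
        Real.sqrt (lossFwd (T s t) x) * Real.sqrt (lossAdj (T s t) ζ) := by
        rw [hηuu, hηus, hη'uu]; ring

end Core

end Summit.AnomalousDissipation.AnomalousDissipation.Theorems.SolenoidalFractalHomogenisation.LagrangianStep.VmodFlat

end
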